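import Summits.BirchSwinnertonDyer.BirchSwinnertonDyer.Theorems.ByReductionTypeAtTwoRankOneSigmaHeightNeronDuplication
import Literature.NumberTheory.EllipticCurves.CanonicalPAdicHeightLocalIndexProofs
import HarnessLib

/-!
# Route `ByReductionTypeAtTwo`, crux `RankOneAtTwoBigImageOddLocal` (item stmt-BirchSwinnertonDyer-23715), line AN62, σ₀-LEMMA BLOCK
# (cell `bsd-f1-sign2`, planner seat `-an` g50; `--supports 23715`, helper):
# **THE LEVEL SHIFTS BY EXACTLY ONE UNDER DOUBLING AT 2 (`a₁ = 0`): `‖x(2Q)‖₂ = 4‖x(Q)‖₂` for `‖x(Q)‖₂ ≥ 4`, hence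
# `‖x(2ᵏQ)‖₂ = 4ᵏ‖x(Q)‖₂` — purely local, the equality case of the tree's `four_mul_padicNorm_le_padicNorm_addX`**

HONEST FRAMING (D-0036/D-0054): THEOREMS ONLY (no definition, no named fact, no `sorry`, no instance).  `V/ℚ` `ℤ`-integral with `a₁ = 0`,
`Q = (x, y)` with `‖x‖₂ ≥ 4` (level `≥ 1`).  Then `Q ≠ −Q` (`Y_ne_negY_of_four_le`) and, by the duplication formula `x(2Q) = φ₂(x)/ψ₂²`
(`addX_self_eq_div`), the ultrametric sizes `‖φ₂(x)‖₂ = ‖x‖₂⁴` (leading term) and `‖ψ₂‖₂ = ‖2y + a₃‖₂ = ½‖y‖₂`, `‖y‖₂² = ‖x‖₂³` give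
`‖x(2Q)‖₂ = 4‖x‖₂` EXACTLY (`norm_addX_self_eq_four_mul`, `norm_x_two_nsmul_eq_four_mul`; `norm_x_two_pow_nsmul_eq`: `‖x(2ᵏQ)‖₂ = 4ᵏ‖x‖₂`;
at level one `‖x(2Q)‖₂ = 16`).  With `a₁` odd the level-one case can jump (`‖a₁x‖₂ = ‖2y‖₂ = 4`), hence `a₁ = 0`.  This pins the Tate tower of
the effective Tate formula (`…SigmaHeightTateFormula`): `lev(2ᵏQ) = lev(Q) + k`.  Nothing here is a statement about `BSDp`; item 23715 stays
OPEN; BSD is proved for no curve.  References: [cite: SilvermanAEC2009, III.2.3(d), IV.3.2, VII.2].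
-/

set_option autoImplicit false

noncomputable section

open scoped Classical

open WeierstrassCurve Literature Literature.NumberTheory.EllipticCurves

namespace Summit.BirchSwinnertonDyer.BirchSwinnertonDyer.Theorems

namespace NaiveSigmaLogAtTwo

/-- `‖y‖₂² = ‖x‖₂³` and `‖y‖₂ ≥ 8` for `‖x‖₂ ≥ 4` (integral equation). [cite: SilvermanAEC2009, VII.2.2] -/
theorem norm_y_sq_eq_of_four_le (V : WeierstrassCurve ℚ) [V.IsIntegral ℤ] {x y : ℚ} (h : V.toAffine.Nonsingular x y)
    (hx : (4 : ℝ) ≤ ‖(x : ℚ_[2])‖) : ‖(y : ℚ_[2])‖ ^ 2 = ‖(x : ℚ_[2])‖ ^ 3 ∧ (8 : ℝ) ≤ ‖(y : ℚ_[2])‖ := by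
  have hx' : (4 : ℚ) ≤ padicNorm 2 x := by
    rw [Padic.eq_padicNorm] at hx; exact_mod_cast hx
  obtain ⟨hsq, -, -⟩ := padicNorm_Y_of_one_lt (W := V) 2 h (by linarith)
  have hsqR : ‖(y : ℚ_[2])‖ ^ 2 = ‖(x : ℚ_[2])‖ ^ 3 := by
    rw [Padic.eq_padicNorm, Padic.eq_padicNorm]; exact_mod_cast hsq
  refine ⟨hsqR, ?_⟩
  have h64 : (64 : ℝ) ≤ ‖(y : ℚ_[2])‖ ^ 2 := by
    rw [hsqR, show (64 : ℝ) = 4 ^ 3 by norm_num]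
    exact pow_le_pow_left₀ (by norm_num) hx 3
  nlinarith [norm_nonneg (y : ℚ_[2]), h64]

/-- A point of level `≥ 1` is not `2`-torsion (`a₁ = 0`): `y ≠ −y − a₃`. [cite: SilvermanAEC2009, VII.2.2, III.2.3] -/
theorem Y_ne_negY_of_four_le (V : WeierstrassCurve ℚ) [V.IsIntegral ℤ] (ha1 : V.a₁ = 0) {x y : ℚ}
    (h : V.toAffine.Nonsingular x y) (hx : (4 : ℝ) ≤ ‖(x : ℚ_[2])‖) : y ≠ V.toAffine.negY x y := by
  intro hy
  obtain ⟨-, hy8⟩ := norm_y_sq_eq_of_four_le V h hx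
  have e : (2 : ℚ) * y = -V.a₃ := by
    rw [WeierstrassCurve.Affine.negY, ha1] at hy; linarith
  have ha3 : ‖(V.a₃ : ℚ_[2])‖ ≤ 1 := (mem_localIntegers_iff 2 _).mp (V.a₃_mem_localIntegers 2)
  have h2 : ‖(2 : ℚ_[2])‖ = 2⁻¹ := by
    have := Padic.norm_p (p := 2); exact_mod_cast this
  have hn : ‖(2 : ℚ_[2]) * (y : ℚ_[2])‖ = ‖(V.a₃ : ℚ_[2])‖ := by
    have e' := congrArg (Rat.cast : ℚ → ℚ_[2]) e
    push_cast at e'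
    rw [e', norm_neg]
  rw [norm_mul, h2] at hn
  linarith

/-- **The level shifts by exactly one under doubling**: `‖x(2Q)‖₂ = 4‖x(Q)‖₂` for `‖x(Q)‖₂ ≥ 4` (`a₁ = 0`, integral equation).
[cite: SilvermanAEC2009, III.2.3(d), IV.3.2] -/
theorem norm_addX_self_eq_four_mul (V : WeierstrassCurve ℚ) [V.IsIntegral ℤ] (ha1 : V.a₁ = 0) {x y : ℚ}
    (h : V.toAffine.Nonsingular x y) (hx : (4 : ℝ) ≤ ‖(x : ℚ_[2])‖) :
    ‖((V.toAffine.addX x x (V.toAffine.slope x x y y) : ℚ) : ℚ_[2])‖ = 4 * ‖(x : ℚ_[2])‖ := by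
  have hy := Y_ne_negY_of_four_le V ha1 h hx
  obtain ⟨hsq, hy8⟩ := norm_y_sq_eq_of_four_le V h hx
  -- integer coefficients
  obtain ⟨A₂, hA2⟩ : ∃ A : ℤ, V.a₂ = A := ⟨(WeierstrassCurve.integralModel ℤ V).a₂, by
    rw [← WeierstrassCurve.integralModel_a₂_eq ℤ V]; exact eq_intCast _ _⟩
  obtain ⟨A₃, hA3⟩ : ∃ A : ℤ, V.a₃ = A := ⟨(WeierstrassCurve.integralModel ℤ V).a₃, by
    rw [← WeierstrassCurve.integralModel_a₃_eq ℤ V]; exact eq_intCast _ _⟩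
  obtain ⟨A₄, hA4⟩ : ∃ A : ℤ, V.a₄ = A := ⟨(WeierstrassCurve.integralModel ℤ V).a₄, by
    rw [← WeierstrassCurve.integralModel_a₄_eq ℤ V]; exact eq_intCast _ _⟩
  obtain ⟨A₆, hA6⟩ : ∃ A : ℤ, V.a₆ = A := ⟨(WeierstrassCurve.integralModel ℤ V).a₆, by
    rw [← WeierstrassCurve.integralModel_a₆_eq ℤ V]; exact eq_intCast _ _⟩
  have hb4 : V.b₄ = 2 * A₄ := by rw [WeierstrassCurve.b₄, ha1, hA3, hA4]; ring
  have hb6 : V.b₆ = A₃ ^ 2 + 4 * A₆ := by rw [WeierstrassCurve.b₆, hA3, hA6]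
  have hb8 : V.b₈ = 4 * A₂ * A₆ + A₂ * A₃ ^ 2 - A₄ ^ 2 := by rw [WeierstrassCurve.b₈, ha1, hA2, hA3, hA4, hA6]; ring
  rw [addX_self_eq_div V.toAffine h.left hy]
  have e4 : V.toAffine.b₄ = V.b₄ := rfl
  have e6 : V.toAffine.b₆ = V.b₆ := rfl
  have e8 : V.toAffine.b₈ = V.b₈ := rfl
  have e1 : V.toAffine.a₁ = V.a₁ := rfl
  have e3 : V.toAffine.a₃ = V.a₃ := rfl
  rw [e4, e6, e8, e1, e3, hb4, hb6, hb8, ha1, hA3]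
  push_cast
  simp only [zero_mul, add_zero]
  set X : ℚ_[2] := (x : ℚ_[2]) with hXdef
  set Y : ℚ_[2] := (y : ℚ_[2]) with hYdef
  have hi := fun n : ℤ => Padic.norm_int_le_one (p := 2) n
  have hX1 : (1 : ℝ) ≤ ‖X‖ := by linarith
  have hX0 : (0 : ℝ) < ‖X‖ := by linarith
  -- numerator: the leading term wins
  have hrest : ‖-(2 * (A₄ : ℚ_[2]) * X ^ 2) - 2 * ((A₃ : ℚ_[2]) ^ 2 + 4 * A₆) * X
      - (4 * (A₂ : ℚ_[2]) * A₆ + A₂ * A₃ ^ 2 - A₄ ^ 2)‖ ≤ ‖X‖ ^ 2 := by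
    have h2 : ‖(2 : ℚ_[2])‖ ≤ 1 := by simpa using hi 2
    have h4 : ‖(4 : ℚ_[2])‖ ≤ 1 := by simpa using hi 4
    have hm : ∀ {u v : ℚ_[2]} {a b : ℝ}, ‖u‖ ≤ a → ‖v‖ ≤ b → 0 ≤ a → ‖u * v‖ ≤ a * b := fun hu hv ha => by
      rw [norm_mul]; exact mul_le_mul hu hv (norm_nonneg _) ha
    have hadd : ∀ {u v : ℚ_[2]} {a : ℝ}, ‖u‖ ≤ a → ‖v‖ ≤ a → ‖u + v‖ ≤ a := fun hu hv =>
      (Padic.nonarchimedean _ _).trans (max_le hu hv)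
    have hsub : ∀ {u v : ℚ_[2]} {a : ℝ}, ‖u‖ ≤ a → ‖v‖ ≤ a → ‖u - v‖ ≤ a := fun {u v a} hu hv => by
      rw [sub_eq_add_neg]; exact hadd hu (by rwa [norm_neg])
    have hX2 : ‖X ^ 2‖ = ‖X‖ ^ 2 := norm_pow _ _
    have hXle : ‖X‖ ≤ ‖X‖ ^ 2 := by nlinarith
    have h1le : (1 : ℝ) ≤ ‖X‖ ^ 2 := by nlinarith
    have t1 : ‖-(2 * (A₄ : ℚ_[2]) * X ^ 2)‖ ≤ ‖X‖ ^ 2 := by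
      rw [norm_neg]
      have := hm (hm h2 (hi A₄) zero_le_one) hX2.le (by norm_num)
      simpa using this
    have t2 : ‖2 * ((A₃ : ℚ_[2]) ^ 2 + 4 * A₆) * X‖ ≤ ‖X‖ ^ 2 := by
      have hc : ‖(A₃ : ℚ_[2]) ^ 2 + 4 * A₆‖ ≤ 1 := by
        refine hadd ?_ ?_
        · rw [norm_pow]; exact pow_le_one₀ (norm_nonneg _) (hi _)
        · simpa using hm h4 (hi A₆) zero_le_one
      have := hm (hm h2 hc zero_le_one) (le_refl ‖X‖) (by norm_num)
      have e : (1 : ℝ) * 1 * ‖X‖ = ‖X‖ := by ring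
      rw [e] at this
      exact this.trans hXle
    have t3 : ‖4 * (A₂ : ℚ_[2]) * A₆ + A₂ * A₃ ^ 2 - A₄ ^ 2‖ ≤ ‖X‖ ^ 2 := by
      refine le_trans ?_ h1le
      refine hsub (hadd ?_ ?_) ?_
      · simpa using hm (hm h4 (hi A₂) zero_le_one) (hi A₆) (by norm_num)
      · have := hm (hi A₂) (show ‖(A₃ : ℚ_[2]) ^ 2‖ ≤ 1 by rw [norm_pow]; exact pow_le_one₀ (norm_nonneg _) (hi _))
          zero_le_one
        simpa using this
      · rw [norm_pow]; exact pow_le_one₀ (norm_nonneg _) (hi _)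
    exact hsub (hsub t1 t2) t3
  have hnum : ‖X ^ 4 - 2 * (A₄ : ℚ_[2]) * X ^ 2 - 2 * ((A₃ : ℚ_[2]) ^ 2 + 4 * A₆) * X
      - (4 * (A₂ : ℚ_[2]) * A₆ + A₂ * A₃ ^ 2 - A₄ ^ 2)‖ = ‖X‖ ^ 4 := by
    have e : X ^ 4 - 2 * (A₄ : ℚ_[2]) * X ^ 2 - 2 * ((A₃ : ℚ_[2]) ^ 2 + 4 * A₆) * X
        - (4 * (A₂ : ℚ_[2]) * A₆ + A₂ * A₃ ^ 2 - A₄ ^ 2)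
        = X ^ 4 + (-(2 * (A₄ : ℚ_[2]) * X ^ 2) - 2 * ((A₃ : ℚ_[2]) ^ 2 + 4 * A₆) * X
          - (4 * (A₂ : ℚ_[2]) * A₆ + A₂ * A₃ ^ 2 - A₄ ^ 2)) := by ring
    have hX4 : ‖X ^ 4‖ = ‖X‖ ^ 4 := norm_pow _ _
    have hlt : ‖X‖ ^ 2 < ‖X‖ ^ 4 := by nlinarith
    rw [e, Padic.add_eq_max_of_ne (by rw [hX4]; exact (ne_of_lt (lt_of_le_of_lt hrest hlt)).symm), hX4,
      max_eq_left (hrest.trans hlt.le)]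
  -- denominator: `‖2y + a₃‖ = ½‖y‖`
  have hden : ‖(2 * Y + (A₃ : ℚ_[2])) ^ 2‖ = 4⁻¹ * ‖X‖ ^ 3 := by
    have h2 : ‖(2 : ℚ_[2])‖ = 2⁻¹ := by
      have := Padic.norm_p (p := 2); exact_mod_cast this
    have h2Y : ‖(2 : ℚ_[2]) * Y‖ = 2⁻¹ * ‖Y‖ := by rw [norm_mul, h2]
    have hA3' : ‖(A₃ : ℚ_[2])‖ < ‖(2 : ℚ_[2]) * Y‖ := by
      rw [h2Y]; linarith [hi A₃]
    have hs : ‖2 * Y + (A₃ : ℚ_[2])‖ = 2⁻¹ * ‖Y‖ := by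
      rw [Padic.add_eq_max_of_ne (ne_of_gt hA3'), max_eq_left hA3'.le, h2Y]
    rw [norm_pow, hs, mul_pow, hsq]
    norm_num
  rw [norm_div, hnum, hden]
  field_simp

/-- **`‖x(2Q)‖₂ = 4‖x(Q)‖₂`** for `2Q = (x′, y′)`, `‖x(Q)‖₂ ≥ 4`, `a₁ = 0`. [cite: SilvermanAEC2009, III.2.3(d), IV.3.2] -/
theorem norm_x_two_nsmul_eq_four_mul (V : WeierstrassCurve ℚ) [V.IsIntegral ℤ] (ha1 : V.a₁ = 0) {x y x' y' : ℚ}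
    (h : V.toAffine.Nonsingular x y) (h' : V.toAffine.Nonsingular x' y')
    (h2 : (2 : ℕ) • (.some x y h : V.toAffine.Point) = .some x' y' h') (hx : (4 : ℝ) ≤ ‖(x : ℚ_[2])‖) :
    ‖(x' : ℚ_[2])‖ = 4 * ‖(x : ℚ_[2])‖ := by
  have hy := Y_ne_negY_of_four_le V ha1 h hx
  rw [two_nsmul, WeierstrassCurve.Affine.Point.add_self_of_Y_ne hy] at h2
  simp only [WeierstrassCurve.Affine.Point.some.injEq] at h2
  rw [← h2.1]
  exact norm_addX_self_eq_four_mul V ha1 h hx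

/-- At level one: `‖x(2Q)‖₂ = 16`. [cite: SilvermanAEC2009, IV.3.2] -/
theorem norm_x_two_nsmul_eq_sixteen (V : WeierstrassCurve ℚ) [V.IsIntegral ℤ] (ha1 : V.a₁ = 0) {x y x' y' : ℚ}
    (h : V.toAffine.Nonsingular x y) (h' : V.toAffine.Nonsingular x' y')
    (h2 : (2 : ℕ) • (.some x y h : V.toAffine.Point) = .some x' y' h') (hx : ‖(x : ℚ_[2])‖ = 4) :
    ‖(x' : ℚ_[2])‖ = 16 := by
  rw [norm_x_two_nsmul_eq_four_mul V ha1 h h' h2 hx.ge, hx]; norm_num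

/-- **The Tate tower is exact**: `‖x(2ᵏQ)‖₂ = 4ᵏ‖x(Q)‖₂` (`lev(2ᵏQ) = lev(Q) + k`) for `‖x(Q)‖₂ ≥ 4`, `a₁ = 0`.
[cite: SilvermanAEC2009, IV.3.2, VII.2] -/
theorem norm_x_two_pow_nsmul_eq (V : WeierstrassCurve ℚ) [V.IsIntegral ℤ] (ha1 : V.a₁ = 0) {x y : ℚ}
    (h : V.toAffine.Nonsingular x y) (hx : (4 : ℝ) ≤ ‖(x : ℚ_[2])‖) (k : ℕ) {x' y' : ℚ}
    (h' : V.toAffine.Nonsingular x' y') (hk : (2 ^ k : ℕ) • (.some x y h : V.toAffine.Point) = .some x' y' h') :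
    ‖(x' : ℚ_[2])‖ = 4 ^ k * ‖(x : ℚ_[2])‖ := by
  induction k generalizing x' y' with
  | zero =>
    simp only [pow_zero, one_smul, WeierstrassCurve.Affine.Point.some.injEq] at hk
    rw [← hk.1]; ring
  | succ k ih =>
    -- `2^(k+1) • P = 2 • (2^k • P)`, and `2^k • P` is affine (else `2^(k+1) • P = 0`)
    have hmul : (2 ^ (k + 1) : ℕ) • (.some x y h : V.toAffine.Point) = (2 : ℕ) • ((2 ^ k : ℕ) • (.some x y h : V.toAffine.Point)) := by
      rw [← mul_nsmul', ← pow_succ']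
    rcases hQ : ((2 ^ k : ℕ) • (.some x y h : V.toAffine.Point)) with _ | ⟨xk, yk, hk'⟩
    · rw [hmul, hQ] at hk
      have h0 : (2 : ℕ) • (0 : V.toAffine.Point) = 0 := nsmul_zero _
      exact absurd (h0.symm.trans hk) (by intro h00; cases h00)
    · have hnk := ih hk' hQ
      have hxk : (4 : ℝ) ≤ ‖(xk : ℚ_[2])‖ := by
        rw [hnk]
        have : (1 : ℝ) ≤ 4 ^ k := one_le_pow₀ (by norm_num)
        nlinarith
      rw [hmul, hQ] at hk
      rw [norm_x_two_nsmul_eq_four_mul V ha1 hk' h' hk hxk, hnk]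
      ring

end NaiveSigmaLogAtTwo

end Summit.BirchSwinnertonDyer.BirchSwinnertonDyer.Theorems
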